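import Mathlib
import HarnessLib
import Literature.MathematicalPhysics.QuantumLattice.FejerTopCutoff

/-!
# Route `KLProgramme` — crux K3, child `KLRegimeTwoPointAssembly` (V7): the ITERATED Tannery lemma over the moving
# Matsubara window (seat hubbard-kl-k3c5-p3, technique «OS-positivity-free direct assembly»)

The interacting part of the two-point representation `twoPointReprCT` (and its free part) is a sum over the `2M` Matsubara
labels `ω : MatsubaraIdx M` of per-frequency momentum averages `F L M ω`; the volume-limit slot `FinalTwoLegVolLimit`
delivers (i) a UNIFORM bound and (ii) PER-FREQUENCY convergence «eventually in `L`, then eventually in `M`» at each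
fixed Matsubara INTEGER `n = matsubaraInt M ω`.  This file proves, once and for all and with no model content, the
dominated-convergence step that turns (i) + (ii) into the iterated limit of the whole Matsubara sum:

* `sum_matsubaraIdx_eq_sum_Ico` — reindexing (with the tree's `matsubaraInt_injective`, `FejerTopCutoff`) `Σ_{ω : Fin 2M} g(n(ω)) = Σ_{n ∈ [-M, M)} g n`;
* `norm_le_of_iterated_dominated` — a per-frequency iterated limit `c n` of a dominated family is dominated, `‖c n‖ ≤ b n`;
* `iterated_matsubara_tannery` — if `‖F L M ω‖ ≤ b (n(ω))` beyond `(L₀, Mstar)` with `Σ b < ∞` and `F L M ω → c n` in the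
  iterated sense at every integer `n`, then `Σ_ω F L M ω → Σ'_{n ∈ ℤ} c n` in the iterated sense
  (`∀ ε > 0, ∃ L₁, ∀ L ≥ L₁, ∃ M₁, ∀ M ≥ M₁, ‖Σ_ω F L M ω − Σ' c‖ ≤ ε`).

Proof: three `ε/3`'s — a finite central set `s ⊂ ℤ` carrying all but `ε/3` of `Σ b`, the per-frequency limits on `s`,
and the window tail `[-M, M) ∖ s` bounded by the `b`-tail.  Pure analysis (Tannery's theorem for a doubly indexed family
with a growing index window); no positivity, analyticity or trace device.  Nothing here asserts anything about the Hubbard model.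
-/

noncomputable section

namespace Summit.HubbardSuperconductivity.HubbardSuperconductivity.Theorems.TwoPointAssembly

set_option linter.dupNamespace false -- summit = problem name (single-conjunct summit), D-0017

open Filter Topology Finset Literature.MathematicalPhysics.QuantumLattice

/-! ## §1 The Matsubara window `[-M, M)` -/

/-- The integer label of a Matsubara index lies in the window `[-M, M)`. -/
theorem matsubaraInt_mem_Ico (M : ℕ) (ω : MatsubaraIdx M) :
    matsubaraInt M ω ∈ Finset.Ico (-(M : ℤ)) M := by
  have h := ω.isLt
  simp only [matsubaraInt, Finset.mem_Ico]
  omega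

/-- Every integer of the window is the label of a Matsubara index. -/
theorem exists_matsubaraInt_eq {M : ℕ} {n : ℤ} (hn : n ∈ Finset.Ico (-(M : ℤ)) M) :
    ∃ ω : MatsubaraIdx M, matsubaraInt M ω = n := by
  rw [Finset.mem_Ico] at hn
  refine ⟨⟨(n + M).toNat, by omega⟩, ?_⟩
  simp only [matsubaraInt]
  omega

/-- The labels of the `2M` Matsubara indices are exactly the window `[-M, M)`. -/
theorem image_matsubaraInt (M : ℕ) :
    (Finset.univ : Finset (MatsubaraIdx M)).image (matsubaraInt M) = Finset.Ico (-(M : ℤ)) M := by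
  ext n
  constructor
  · intro h
    obtain ⟨ω, _, rfl⟩ := Finset.mem_image.1 h
    exact matsubaraInt_mem_Ico M ω
  · intro h
    obtain ⟨ω, hω⟩ := exists_matsubaraInt_eq h
    exact Finset.mem_image.2 ⟨ω, Finset.mem_univ _, hω⟩

/-- **Reindexing a Matsubara sum by the integer label**: `Σ_{ω} g(n(ω)) = Σ_{n ∈ [-M, M)} g n`. -/
theorem sum_matsubaraIdx_eq_sum_Ico {E : Type*} [AddCommMonoid E] (M : ℕ) (g : ℤ → E) :
    ∑ ω : MatsubaraIdx M, g (matsubaraInt M ω) = ∑ n ∈ Finset.Ico (-(M : ℤ)) M, g n := by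
  rw [← image_matsubaraInt, Finset.sum_image fun a _ b _ h => matsubaraInt_injective M h]

/-- A finite set of integers sits inside the window `[-M, M)` once `M` exceeds all its absolute values. -/
theorem subset_Ico_of_sup_natAbs_lt (s : Finset ℤ) {M : ℕ} (hM : s.sup Int.natAbs < M) :
    s ⊆ Finset.Ico (-(M : ℤ)) M := by
  intro n hn
  have h : n.natAbs ≤ s.sup Int.natAbs := Finset.le_sup (f := Int.natAbs) hn
  rw [Finset.mem_Ico]
  omega

/-! ## §2 Domination passes to the per-frequency limits -/

/-- **A per-frequency iterated limit of a dominated family is dominated**: if `‖F L M ω‖ ≤ b n` (label `n`) beyond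
`(L₀, Mstar)` and `F L M ω → c n` in the iterated sense at the label `n`, then `‖c n‖ ≤ b n`. -/
theorem norm_le_of_iterated_dominated (F : (L M : ℕ) → MatsubaraIdx M → ℂ) (c : ℤ → ℂ) (b : ℤ → ℝ)
    (L₀ : ℕ) (Mstar : ℕ → ℕ)
    (hdom : ∀ L, L₀ ≤ L → ∀ M, Mstar L ≤ M → ∀ ω : MatsubaraIdx M, ‖F L M ω‖ ≤ b (matsubaraInt M ω))
    (hlim : ∀ n : ℤ, ∀ ε : ℝ, 0 < ε → ∃ L₁ : ℕ, ∀ L, L₁ ≤ L → ∃ M₁ : ℕ, ∀ M, M₁ ≤ M →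
      ∀ ω : MatsubaraIdx M, matsubaraInt M ω = n → ‖F L M ω - c n‖ ≤ ε)
    (n : ℤ) : ‖c n‖ ≤ b n := by
  refine le_of_forall_pos_le_add fun η hη => ?_
  obtain ⟨L₁, hL₁⟩ := hlim n η hη
  set L : ℕ := max L₀ L₁ with hL
  obtain ⟨M₁, hM₁⟩ := hL₁ L (le_max_right _ _)
  set M : ℕ := max (Mstar L) (max M₁ (n.natAbs + 1)) with hM
  have hwin : n ∈ Finset.Ico (-(M : ℤ)) M := by
    have : n.natAbs + 1 ≤ M := (le_max_right _ _).trans (le_max_right _ _)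
    rw [Finset.mem_Ico]
    omega
  obtain ⟨ω, hω⟩ := exists_matsubaraInt_eq hwin
  have h1 : ‖F L M ω‖ ≤ b n := by
    rw [← hω]
    exact hdom L (le_max_left _ _) M (le_max_left _ _) ω
  have h2 : ‖F L M ω - c n‖ ≤ η := hM₁ M ((le_max_left _ _).trans (le_max_right _ _)) ω hω
  calc ‖c n‖ = ‖F L M ω - (F L M ω - c n)‖ := by rw [sub_sub_cancel]
    _ ≤ ‖F L M ω‖ + ‖F L M ω - c n‖ := norm_sub_le _ _
    _ ≤ b n + η := add_le_add h1 h2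

/-! ## §3 The iterated Tannery lemma -/

/-- **Iterated Tannery over the moving Matsubara window.**  Let `F L M : MatsubaraIdx M → ℂ` be dominated beyond
`(L₀, Mstar)` by a summable `b ∘ matsubaraInt` and converge, at every fixed integer label `n`, to `c n` in the iterated
sense «eventually in `L`, then eventually in `M`».  Then `Σ_ω F L M ω → Σ'_{n ∈ ℤ} c n` in the same iterated sense. -/
theorem iterated_matsubara_tannery (F : (L M : ℕ) → MatsubaraIdx M → ℂ) (c : ℤ → ℂ) (b : ℤ → ℝ)
    (hb : Summable b) (L₀ : ℕ) (Mstar : ℕ → ℕ)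
    (hdom : ∀ L, L₀ ≤ L → ∀ M, Mstar L ≤ M → ∀ ω : MatsubaraIdx M, ‖F L M ω‖ ≤ b (matsubaraInt M ω))
    (hlim : ∀ n : ℤ, ∀ ε : ℝ, 0 < ε → ∃ L₁ : ℕ, ∀ L, L₁ ≤ L → ∃ M₁ : ℕ, ∀ M, M₁ ≤ M →
      ∀ ω : MatsubaraIdx M, matsubaraInt M ω = n → ‖F L M ω - c n‖ ≤ ε) :
    ∀ ε : ℝ, 0 < ε → ∃ L₁ : ℕ, ∀ L, L₁ ≤ L → ∃ M₁ : ℕ, ∀ M, M₁ ≤ M →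
      ‖∑ ω : MatsubaraIdx M, F L M ω - ∑' n : ℤ, c n‖ ≤ ε := by
  intro ε hε
  -- domination of the limits, summability, nonnegativity
  have hcb : ∀ n, ‖c n‖ ≤ b n := norm_le_of_iterated_dominated F c b L₀ Mstar hdom hlim
  have hb0 : ∀ n, 0 ≤ b n := fun n => (norm_nonneg _).trans (hcb n)
  have hc : Summable c := Summable.of_norm_bounded hb hcb
  have hcn : Summable fun n => ‖c n‖ := Summable.of_nonneg_of_le (fun _ => norm_nonneg _) hcb hb
  -- (1) a finite central set `s` carrying all but `ε/3` of `Σ b`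
  have hε3 : 0 < ε / 3 := by positivity
  obtain ⟨s, hs⟩ : ∃ s : Finset ℤ, ∑' n, b n - ∑ n ∈ s, b n ≤ ε / 3 := by
    obtain ⟨s, hs⟩ := Metric.tendsto_atTop.1 (tendsto_tsum_compl_atTop_zero b) (ε / 3) hε3
    refine ⟨s, ?_⟩
    have h := hs s le_rfl
    rw [Real.dist_eq, sub_zero] at h
    have h2 : ∑ n ∈ s, b n + ∑' n : {n // n ∉ s}, b n = ∑' n, b n := hb.sum_add_tsum_subtype_compl s
    rw [← h2]
    linarith [abs_lt.1 h]
  have htail_b : ∀ t : Finset ℤ, Disjoint t s → ∑ n ∈ t, b n ≤ ε / 3 := by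
    intro t hts
    have h1 : ∑ n ∈ t ∪ s, b n ≤ ∑' n, b n := hb.sum_le_tsum (t ∪ s) fun n _ => hb0 n
    rw [Finset.sum_union hts] at h1
    linarith
  have htail_c : ‖∑' n, c n - ∑ n ∈ s, c n‖ ≤ ε / 3 := by
    have h1 : ∑ n ∈ s, c n + ∑' n : {n // n ∉ s}, c n = ∑' n, c n := hc.sum_add_tsum_subtype_compl s
    have h2 : ∑ n ∈ s, b n + ∑' n : {n // n ∉ s}, b n = ∑' n, b n := hb.sum_add_tsum_subtype_compl s
    have h3 : ‖∑' n : {n // n ∉ s}, c n‖ ≤ ∑' n : {n // n ∉ s}, b n := by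
      refine (norm_tsum_le_tsum_norm (hcn.subtype _)).trans ?_
      exact (hcn.subtype _).tsum_le_tsum (fun n => hcb n) (hb.subtype _)
    rw [show ∑' n, c n - ∑ n ∈ s, c n = ∑' n : {n // n ∉ s}, c n by rw [← h1]; ring]
    linarith
  -- (2) the per-frequency limits on `s`, tolerance `η = ε / (3 (|s| + 1))`
  set η : ℝ := ε / (3 * (s.card + 1)) with hη_def
  have hη : 0 < η := by positivity
  have hηsum : (s.card : ℝ) * η ≤ ε / 3 := by
    have h1 : ((s.card : ℝ) + 1) * η = ε / 3 := by
      rw [hη_def]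
      field_simp
    nlinarith [hη]
  choose Lf hLf using fun n => hlim n η hη
  set N : ℕ := s.sup Int.natAbs with hN
  refine ⟨max L₀ (s.sup Lf), fun L hL => ?_⟩
  have hL0 : L₀ ≤ L := (le_max_left _ _).trans hL
  have key : ∀ n : ℤ, ∃ M₁ : ℕ, n ∈ s → ∀ M, M₁ ≤ M →
      ∀ ω : MatsubaraIdx M, matsubaraInt M ω = n → ‖F L M ω - c n‖ ≤ η := by
    intro n
    by_cases hn : n ∈ s
    · have hLn : Lf n ≤ L := ((Finset.le_sup (f := Lf) hn).trans (le_max_right _ _)).trans hL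
      obtain ⟨M₁, hM₁⟩ := hLf n L hLn
      exact ⟨M₁, fun _ => hM₁⟩
    · exact ⟨0, fun h => absurd h hn⟩
  choose Mf hMf using key
  refine ⟨max (Mstar L) (max (s.sup Mf) (N + 1)), fun M hM => ?_⟩
  have hMstar : Mstar L ≤ M := (le_max_left _ _).trans hM
  have hMN : N < M := by
    have : N + 1 ≤ M := ((le_max_right _ _).trans (le_max_right _ _)).trans hM
    omega
  have hsW : s ⊆ Finset.Ico (-(M : ℤ)) M := subset_Ico_of_sup_natAbs_lt s hMN
  -- the window function `t` on `ℤ`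
  set t : ℤ → ℂ := fun n =>
    if h : -(M : ℤ) ≤ n ∧ n < M then F L M ⟨(n + M).toNat, by omega⟩ else 0 with ht_def
  have ht_int : ∀ ω : MatsubaraIdx M, t (matsubaraInt M ω) = F L M ω := by
    intro ω
    have hω := matsubaraInt_mem_Ico M ω
    rw [Finset.mem_Ico] at hω
    rw [ht_def]
    simp only
    rw [dif_pos hω]
    congr 1
    apply Fin.ext
    have h2 := ω.isLt
    simp only [matsubaraInt]
    omega
  have hsumt : ∑ ω : MatsubaraIdx M, F L M ω = ∑ n ∈ Finset.Ico (-(M : ℤ)) M, t n := by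
    rw [← sum_matsubaraIdx_eq_sum_Ico M t]
    exact Finset.sum_congr rfl fun ω _ => (ht_int ω).symm
  -- `t` on the window: dominated, and close to `c` on `s`
  have ht_dom : ∀ n ∈ Finset.Ico (-(M : ℤ)) M, ‖t n‖ ≤ b n := by
    intro n hn
    obtain ⟨ω, hω⟩ := exists_matsubaraInt_eq hn
    rw [← hω, ht_int ω]
    exact hdom L hL0 M hMstar ω
  have ht_lim : ∀ n ∈ s, ‖t n - c n‖ ≤ η := by
    intro n hn
    obtain ⟨ω, hω⟩ := exists_matsubaraInt_eq (hsW hn)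
    rw [← hω, ht_int ω]
    have hMf1 : Mf (matsubaraInt M ω) ≤ M := by
      have h1 : Mf n ≤ s.sup Mf := Finset.le_sup (f := Mf) hn
      rw [hω]
      exact (h1.trans (le_max_left _ _)).trans ((le_max_right _ _).trans hM)
    exact hMf (matsubaraInt M ω) (hω ▸ hn) M hMf1 ω rfl
  -- (3) assemble the three pieces
  rw [hsumt, ← Finset.sum_sdiff hsW]
  have hdisj : Disjoint (Finset.Ico (-(M : ℤ)) M \ s) s := Finset.sdiff_disjoint
  have e1 : ‖∑ n ∈ Finset.Ico (-(M : ℤ)) M \ s, t n‖ ≤ ε / 3 := by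
    refine (norm_sum_le _ _).trans ?_
    refine le_trans (Finset.sum_le_sum fun n hn => ht_dom n (Finset.mem_sdiff.1 hn).1) ?_
    exact htail_b _ hdisj
  have e2 : ‖∑ n ∈ s, t n - ∑ n ∈ s, c n‖ ≤ ε / 3 := by
    rw [← Finset.sum_sub_distrib]
    refine (norm_sum_le _ _).trans ?_
    refine le_trans (Finset.sum_le_sum fun n hn => ht_lim n hn) ?_
    rw [Finset.sum_const, nsmul_eq_mul]
    exact hηsum
  calc ‖∑ n ∈ Finset.Ico (-(M : ℤ)) M \ s, t n + ∑ n ∈ s, t n - ∑' n, c n‖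
      = ‖∑ n ∈ Finset.Ico (-(M : ℤ)) M \ s, t n + (∑ n ∈ s, t n - ∑ n ∈ s, c n)
          - (∑' n, c n - ∑ n ∈ s, c n)‖ := by congr 1; ring
    _ ≤ ‖∑ n ∈ Finset.Ico (-(M : ℤ)) M \ s, t n + (∑ n ∈ s, t n - ∑ n ∈ s, c n)‖
          + ‖∑' n, c n - ∑ n ∈ s, c n‖ := norm_sub_le _ _
    _ ≤ ‖∑ n ∈ Finset.Ico (-(M : ℤ)) M \ s, t n‖ + ‖∑ n ∈ s, t n - ∑ n ∈ s, c n‖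
          + ‖∑' n, c n - ∑ n ∈ s, c n‖ := by gcongr; exact norm_add_le _ _
    _ ≤ ε / 3 + ε / 3 + ε / 3 := by gcongr
    _ = ε := by ring

/-- **Corollary (scaled)**: the same for `a • Σ_ω F L M ω → a • Σ' c` with a fixed scalar `a` (e.g. `1/β`). -/
theorem iterated_matsubara_tannery_mul (a : ℂ) (F : (L M : ℕ) → MatsubaraIdx M → ℂ) (c : ℤ → ℂ) (b : ℤ → ℝ)
    (hb : Summable b) (L₀ : ℕ) (Mstar : ℕ → ℕ)
    (hdom : ∀ L, L₀ ≤ L → ∀ M, Mstar L ≤ M → ∀ ω : MatsubaraIdx M, ‖F L M ω‖ ≤ b (matsubaraInt M ω))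
    (hlim : ∀ n : ℤ, ∀ ε : ℝ, 0 < ε → ∃ L₁ : ℕ, ∀ L, L₁ ≤ L → ∃ M₁ : ℕ, ∀ M, M₁ ≤ M →
      ∀ ω : MatsubaraIdx M, matsubaraInt M ω = n → ‖F L M ω - c n‖ ≤ ε) :
    ∀ ε : ℝ, 0 < ε → ∃ L₁ : ℕ, ∀ L, L₁ ≤ L → ∃ M₁ : ℕ, ∀ M, M₁ ≤ M →
      ‖a * ∑ ω : MatsubaraIdx M, F L M ω - a * ∑' n : ℤ, c n‖ ≤ ε := by
  intro ε hε
  by_cases ha : a = 0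
  · refine ⟨0, fun L _ => ⟨0, fun M _ => ?_⟩⟩
    simp [ha, hε.le]
  · have hapos : 0 < ‖a‖ := norm_pos_iff.2 ha
    obtain ⟨L₁, hL₁⟩ := iterated_matsubara_tannery F c b hb L₀ Mstar hdom hlim (ε / ‖a‖) (div_pos hε hapos)
    refine ⟨L₁, fun L hL => ?_⟩
    obtain ⟨M₁, hM₁⟩ := hL₁ L hL
    refine ⟨M₁, fun M hM => ?_⟩
    rw [← mul_sub, norm_mul]
    have := hM₁ M hM
    rwa [le_div_iff₀ hapos, mul_comm] at this

end Summit.HubbardSuperconductivity.HubbardSuperconductivity.Theorems.TwoPointAssembly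

end
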